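import Literature.MathematicalPhysics.PowerSystems.QuadraticDroopDynamicShuntLoads
import Literature.Analysis.ODE.IndexOneDAEStability
import HarnessLib

/-!
# Quadratic droop control with dynamic shunt loads — Theorem 3.5's «locally exponentially stable»
# at the nonlinear differential-algebraic tier (Simpson-Porco–Dörfler–Bullo 2017, Theorem 3.5)

Topic `Literature/MathematicalPhysics/PowerSystems` (LADDER-GRIDFUSION rung G3.b, quadratic-droop lineage;
seat gridfusion-lit-2, g15).  Companion of `QuadraticDroopDynamicShuntLoads.lean` (SPDB2017 Theorem 3.5
at the reduced-matrix tier: the equilibrium `(E_L^{DS}, E_I^{DS}, b^{DS})`, the extended linearisation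
`[[𝒥_LL, 𝒥_Ld], [𝒥_dL, 𝒥_dd]]`, its reduced matrix `dsRedStateMatrix` Hurwitz with `𝒥_LL` invertible —
`theorem_3_5_redStateMatrix`) and of the model-free DAE lever `Analysis/ODE/IndexOneDAEStability.lean`
(Riaza's reduction of a semi-explicit index-one DAE to its underlying ODE + Khalil's Theorem 4.7:
`exists_expStable_of_reducedJacobian_eig_re_neg`).  Here the two are joined: the print's conclusion
«the corresponding equilibrium point `(E_L^{DS}, E_I^{DS}, b^{DS})` of the system (3.3), (3.16) is locally
exponentially stable» (p0012 L36–L38) for the DIFFERENTIAL-ALGEBRAIC closed loop (3.3), (3.16) itself.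

THE OBJECTS.  The flat state `x = (E_L | E_I, b) ∈ ℝ^{n + (m + n)}` (`dsVolt x = (E_L, E_I)`, `dsSh x = b`,
`dsPack`); the DAE field `dsDAEField Q_L T x` = (load rows of (3.3) with `Q_l(E_l) = b_lE_l²` |
`τ_i⁻¹ ×` inverter rows, `T_l⁻¹(Q_l − E_l²b_l)`), so that a C¹ solution of the extended DAE (3.3),
(3.16) on `[0, T']` is exactly an `IsSemiExplicitDAESolutionOn (dsDAEField Q_L T)` curve (load rows
vanish; `Ė_I`, `ḃ` as printed); its Jacobian field `dsDAEJac T x` (the companion's blocks at a general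
state, masses divided into the differential rows).

WHAT THIS FILE PROVES (0 named facts).
* §1 packing lemmas; **`hasFDerivAt_dsDAEField`** (every `x`: the DAE field is Fréchet differentiable
  with derivative `dsDAEJac T x` — from the companion's `hasFDerivAt_dsField` by the linear repacking);
  `continuous_dsDAEJac`; at the state `(E_L, W₂(E_L, E_I*), b)`: `dsDAEJac` in the companion's blocks
  (`dsDAEJac_pack`), `(dsDAEJac)_𝔞𝔞 = 𝒥_LL`, and **`reducedJacobian (dsDAEJac) = dsRedStateMatrix`**.
* §2 **`dsEquilibrium_locallyExpStable`**: at a state `(E_L, W₂(E_L, E_I*), b)` which is an equilibrium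
  of (3.3), (3.16), if `𝒥_LL` is invertible and the reduced matrix is Hurwitz then there are
  `ρ, k, λ > 0` such that every C¹ solution of the DAE on `[0, T']` starting within `ρ` of it satisfies
  `‖x(t) − x*‖ ≤ k‖x(0) − x*‖e^{−λt}` (BY NAME from the DAE lever).
* §3 **`theorem_3_5_locallyExpStable`** — THEOREM 3.5 AS PRINTED, for the model: under Proposition 7.2's
  data, `τ, T > 0` and Theorem 3.3 (ii) at `I_shunt = 0`, for all sufficiently small inductive demands
  `Q_L < 0` the equilibrium `x* = (E_L^{DS}, E_I^{DS}, b^{DS})` exists (companion) AND is locally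
  exponentially stable for the differential-algebraic system (3.3), (3.16) in the above sense;
  `theorem_3_5_locallyExpStable_of_network` from branch data.

THREE COLUMNS / NOT CLAIMED.  MODEL statements ((3.3) + (3.16), decoupled reactive power flow).  Existence
/ uniqueness of DAE solutions from consistent initial data is not part of the statement (the estimate
holds for every C¹ solution); `ρ, k, λ` existential; «sufficiently small» = `∀ᶠ Q_L in 𝓝 0` restricted
to `Q_L < 0`.  Nothing here says a microgrid is stable.

## References

* J. W. Simpson-Porco, F. Dörfler, F. Bullo, *Voltage stabilization in microgrids via quadratic droop
  control*, IEEE TAC 62 (2017) = arXiv:1507.00431: §3.3 Theorem 3.5 (p0012 L28–L38), Appendix A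
  (p0019 L68–L71), proof of Theorem 3.2 ([RR:04]). [SimpsonporcoDorflerBullo2017]
* R. Riaza, *Differential-Algebraic Systems*, World Scientific 2008, §3.1. [Riaza2008]
* H. K. Khalil, *Nonlinear Systems*, 3rd ed., 2002, Theorem 4.7. [Khalil2002]

AI-produced formalisation (LADDER-GRIDFUSION seat gridfusion-lit-2 g15, 2026-08-28).
-/

noncomputable section

open Finset Filter Set
open scoped Matrix BigOperators Topology

namespace Literature.MathematicalPhysics.PowerSystems

open _root_.Matrix Literature.LinearAlgebra.Matrix
open Literature.MathematicalPhysics.KineticTheory.HeatConduction (IsHurwitz)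
open Literature.Analysis.ODE (IsSemiExplicitDAESolutionOn reducedJacobian
  exists_expStable_of_reducedJacobian_eig_re_neg)

namespace QuadDroopNetwork

variable {n m : ℕ} (W : QuadDroopNetwork n m)

/-! ## §1 The flat state `(E_L | E_I, b)`, the DAE field and its Jacobian field -/

/-- The voltages `(E_L, E_I)` of a flat state `x = (E_L | E_I, b)`. [cite: SimpsonporcoDorflerBullo2017, §3.3 Theorem 3.5 («the corresponding equilibrium point `(E_L^{DS}, E_I^{DS}, b^{DS})` of the system (3.3), (3.16)»)] -/
def dsVolt (x : Fin n ⊕ (Fin m ⊕ Fin n) → ℝ) : Fin n ⊕ Fin m → ℝ := fun k => x (Sum.map id Sum.inl k)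

/-- The shunt susceptances `b` of a flat state `x = (E_L | E_I, b)`. [cite: SimpsonporcoDorflerBullo2017, §3.3 eq. (3.16)] -/
def dsSh (x : Fin n ⊕ (Fin m ⊕ Fin n) → ℝ) : Fin n → ℝ := fun l => x (Sum.inr (Sum.inr l))

/-- Packing `(E, b) ↦ (E_L | E_I, b)`. [cite: SimpsonporcoDorflerBullo2017, §3.3 Theorem 3.5] -/
def dsPack (E : Fin n ⊕ Fin m → ℝ) (b : Fin n → ℝ) : Fin n ⊕ (Fin m ⊕ Fin n) → ℝ :=
  Sum.elim (fun l => E (Sum.inl l)) (Sum.elim (fun i => E (Sum.inr i)) b)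

omit W in
/-- Unpacking a packed state: the voltages. [cite: SimpsonporcoDorflerBullo2017, §3.3 Theorem 3.5 (the state `(E_L, E_I, b)` of (3.3), (3.16))] -/
@[simp] theorem dsVolt_dsPack (E : Fin n ⊕ Fin m → ℝ) (b : Fin n → ℝ) :
    dsVolt (m := m) (dsPack E b) = E := by
  funext k; cases k <;> rfl

omit W in
/-- Unpacking a packed state: the shunts. [cite: SimpsonporcoDorflerBullo2017, §3.3 Theorem 3.5 (the state `(E_L, E_I, b)` of (3.3), (3.16))] -/
@[simp] theorem dsSh_dsPack (E : Fin n ⊕ Fin m → ℝ) (b : Fin n → ℝ) :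
    dsSh (m := m) (dsPack E b) = b := rfl

/-- **The differential-algebraic closed loop (3.3), (3.16) as one field on `ℝ^{n + (m + n)}`** (masses
divided into the differential rows): algebraic components = the load rows of (3.3) with
`Q_l(E_l) = b_lE_l²`; differential components = `τ_i⁻¹ ×` inverter row `i` of (3.3) and
`T_l⁻¹(Q_l − E_l²b_l)` (3.16).  A C¹ curve is a solution of the DAE (3.3), (3.16) on `[0, T']` iff it is an
`IsSemiExplicitDAESolutionOn (dsDAEField Q_L T)` curve.
[cite: SimpsonporcoDorflerBullo2017, §3.1 eq. (3.3) and §3.3 eq. (3.16) («`Tḃ_dyn-shunt = Q_L − [E_L]²b_dyn-shunt` … `T` is a diagonal matrix of time constants»)] -/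
def dsDAEField (Q T : Fin n → ℝ) (x : Fin n ⊕ (Fin m ⊕ Fin n) → ℝ) : Fin n ⊕ (Fin m ⊕ Fin n) → ℝ :=
  Sum.elim (fun l => W.dsField Q (dsVolt x) (dsSh x) (Sum.inl (Sum.inl l)))
    (Sum.elim (fun i => (W.τ i)⁻¹ * W.dsField Q (dsVolt x) (dsSh x) (Sum.inl (Sum.inr i)))
      (fun l => (T l)⁻¹ * W.dsField Q (dsVolt x) (dsSh x) (Sum.inr l)))

/-- The load-model derivatives `2b_lE_l` along a flat state. [cite: SimpsonporcoDorflerBullo2017, proof of Theorem 3.2 eq. (3.11′) (`D_ll = dQ_l/dE_l`) with (3.16)] -/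
def dsDQx (x : Fin n ⊕ (Fin m ⊕ Fin n) → ℝ) : Fin n → ℝ := dsDQ (fun l => x (Sum.inl l)) (dsSh x)

/-- The inverse masses `(τ⁻¹, T⁻¹)` of the differential rows. [cite: SimpsonporcoDorflerBullo2017, §3.1 eq. (3.3) (`τ_i`) and §3.3 eq. (3.16) (`T`)] -/
def dsMass (T : Fin n → ℝ) : Fin m ⊕ Fin n → ℝ := Sum.elim (fun i => (W.τ i)⁻¹) fun l => (T l)⁻¹

/-- **The Jacobian field of the DAE (3.3), (3.16)** at a general flat state, in blocks (algebraic `E_L` |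
differential `(E_I, b)`): `[[J_LL, [J_LI, [E_L²]]], Λ_m[[J_IL; −2[E_Lb]], [J_II, 0; 0, −[E_L²]]]]`,
`Λ_m = diag(τ⁻¹, T⁻¹)`, `J` the Jacobian (3.11′) of (3.3) with `D_ll = 2b_lE_l`.
[cite: SimpsonporcoDorflerBullo2017, proof of Theorem 3.2 eq. (3.11′) and Appendix A proof of Theorem 3.5 («the extended dynamics (3.3), (3.16)», p0019 L70–L71)] -/
def dsDAEJac (T : Fin n → ℝ) (x : Fin n ⊕ (Fin m ⊕ Fin n) → ℝ) :
    Matrix (Fin n ⊕ (Fin m ⊕ Fin n)) (Fin n ⊕ (Fin m ⊕ Fin n)) ℝ :=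
  Matrix.fromBlocks
    (W.jacLL (dsDQx x) (dsVolt x))
    (Matrix.fromCols (W.jacLI (dsDQx x) (dsVolt x)) (diagonal fun l => x (Sum.inl l) ^ 2))
    (diagonal (W.dsMass T) *
      Matrix.fromRows (W.jacIL (dsDQx x) (dsVolt x)) (diagonal fun l => -(2 * x (Sum.inl l) * dsSh x l)))
    (diagonal (W.dsMass T) *
      Matrix.fromBlocks (W.jacII (dsDQx x) (dsVolt x)) 0 0 (-diagonal fun l => x (Sum.inl l) ^ 2))

/-- `J` as the block matrix of its blocks. [folklore] -/
private theorem jac_eq_fromBlocks' (dQ : Fin n → ℝ) (E : Fin n ⊕ Fin m → ℝ) :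
    W.jac dQ E = Matrix.fromBlocks (W.jacLL dQ E) (W.jacLI dQ E) (W.jacIL dQ E) (W.jacII dQ E) :=
  (Matrix.fromBlocks_toBlocks _).symm

variable {W}

/-- **The DAE field is Fréchet differentiable everywhere, with derivative `dsDAEJac`** (the companion's
`hasFDerivAt_dsField` repacked on the flat state and scaled by the inverse masses).
[cite: SimpsonporcoDorflerBullo2017, proof of Theorem 3.2 eq. (3.11′) («Jacobian matrix `J`») and Appendix A proof of Theorem 3.5 (p0019 L70–L71)] -/
theorem hasFDerivAt_dsDAEField (Q T : Fin n → ℝ) (x : Fin n ⊕ (Fin m ⊕ Fin n) → ℝ) :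
    HasFDerivAt (W.dsDAEField Q T)
      (LinearMap.toContinuousLinearMap (Matrix.toLin' (W.dsDAEJac T x))) x := by
  obtain ⟨D, hD, hval⟩ := W.hasFDerivAt_dsField Q (dsVolt x) (dsSh x)
  -- the linear repacking `x ↦ (dsVolt x, dsSh x)`
  set S : (Fin n ⊕ (Fin m ⊕ Fin n) → ℝ) →L[ℝ] ((Fin n ⊕ Fin m → ℝ) × (Fin n → ℝ)) :=
    (ContinuousLinearMap.pi fun k : Fin n ⊕ Fin m =>
        (ContinuousLinearMap.proj (Sum.map id Sum.inl k) : (Fin n ⊕ (Fin m ⊕ Fin n) → ℝ) →L[ℝ] ℝ)).prod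
      (ContinuousLinearMap.pi fun l : Fin n =>
        (ContinuousLinearMap.proj (Sum.inr (Sum.inr l)) : (Fin n ⊕ (Fin m ⊕ Fin n) → ℝ) →L[ℝ] ℝ))
    with hSdef
  have hSapply : ∀ h, S h = (dsVolt h, dsSh h) := fun h => rfl
  have hS : HasFDerivAt (fun x' : Fin n ⊕ (Fin m ⊕ Fin n) → ℝ => (dsVolt x', dsSh x')) S x := by
    have h := S.hasFDerivAt (x := x)
    exact h
  have hG0 := hD.comp x hS
  have hG : HasFDerivAt (fun x' => W.dsField Q (dsVolt x') (dsSh x')) (D.comp S) x := hG0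
  have hGk : ∀ k, HasFDerivAt (fun x' => W.dsField Q (dsVolt x') (dsSh x') k)
      ((ContinuousLinearMap.proj k : ((Fin n ⊕ Fin m) ⊕ Fin n → ℝ) →L[ℝ] ℝ).comp (D.comp S)) x :=
    fun k => hasFDerivAt_pi'.1 hG k
  -- the value of `D` on a repacked vector, block by block
  have hDval : ∀ h : Fin n ⊕ (Fin m ⊕ Fin n) → ℝ, D (S h) = Sum.elim
      (W.jac (dsDQx x) (dsVolt x) *ᵥ dsVolt h + Sum.elim (fun l => x (Sum.inl l) ^ 2 * dsSh h l) 0)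
      (fun l => -(2 * x (Sum.inl l) * dsSh x l) * h (Sum.inl l) - x (Sum.inl l) ^ 2 * dsSh h l) := by
    intro h
    rw [hSapply, hval]
    rfl
  have hjac : ∀ h : Fin n ⊕ (Fin m ⊕ Fin n) → ℝ, W.jac (dsDQx x) (dsVolt x) *ᵥ dsVolt h
      = Sum.elim (W.jacLL (dsDQx x) (dsVolt x) *ᵥ (fun l => h (Sum.inl l))
          + W.jacLI (dsDQx x) (dsVolt x) *ᵥ fun i => h (Sum.inr (Sum.inl i)))
        (W.jacIL (dsDQx x) (dsVolt x) *ᵥ (fun l => h (Sum.inl l))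
          + W.jacII (dsDQx x) (dsVolt x) *ᵥ fun i => h (Sum.inr (Sum.inl i))) := by
    intro h
    rw [jac_eq_fromBlocks', Matrix.fromBlocks_mulVec]
    rfl
  -- the candidate derivative, component by component
  set L : (Fin n ⊕ (Fin m ⊕ Fin n) → ℝ) →L[ℝ] (Fin n ⊕ (Fin m ⊕ Fin n) → ℝ) :=
    LinearMap.toContinuousLinearMap (Matrix.toLin' (W.dsDAEJac T x)) with hL
  have hLapply : ∀ h k, ((ContinuousLinearMap.proj k : (Fin n ⊕ (Fin m ⊕ Fin n) → ℝ) →L[ℝ] ℝ).comp L) h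
      = (W.dsDAEJac T x *ᵥ h) k := fun h k => by
    simp [hL, Matrix.toLin'_apply]
  have hrow : ∀ h : Fin n ⊕ (Fin m ⊕ Fin n) → ℝ, W.dsDAEJac T x *ᵥ h = Sum.elim
      (W.jacLL (dsDQx x) (dsVolt x) *ᵥ (fun l => h (Sum.inl l))
        + (W.jacLI (dsDQx x) (dsVolt x) *ᵥ (fun i => h (Sum.inr (Sum.inl i)))
          + diagonal (fun l => x (Sum.inl l) ^ 2) *ᵥ fun l => h (Sum.inr (Sum.inr l))))
      (diagonal (W.dsMass T) *ᵥ
        (Sum.elim (W.jacIL (dsDQx x) (dsVolt x) *ᵥ fun l => h (Sum.inl l))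
            (diagonal (fun l => -(2 * x (Sum.inl l) * dsSh x l)) *ᵥ fun l => h (Sum.inl l))
          + Sum.elim (W.jacII (dsDQx x) (dsVolt x) *ᵥ (fun i => h (Sum.inr (Sum.inl i))) + 0)
              (0 + (-diagonal fun l => x (Sum.inl l) ^ 2) *ᵥ fun l => h (Sum.inr (Sum.inr l))))) := by
    intro h
    rw [dsDAEJac, Matrix.fromBlocks_mulVec, Matrix.fromCols_mulVec, ← Matrix.mulVec_mulVec,
      ← Matrix.mulVec_mulVec, Matrix.fromRows_mulVec, Matrix.fromBlocks_mulVec, ← Matrix.mulVec_add,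
      Matrix.zero_mulVec, Matrix.zero_mulVec]
    rfl
  rw [hasFDerivAt_pi']
  intro k
  rcases k with l | i | l
  · -- load row `l`
    refine ((hGk (Sum.inl (Sum.inl l))).congr_of_eventuallyEq
      (Eventually.of_forall fun x' => ?_)).congr_fderiv ?_
    · simp only [dsDAEField, Sum.elim_inl]
    · ext h
      rw [hLapply, hrow, ContinuousLinearMap.comp_apply, ContinuousLinearMap.proj_apply,
        ContinuousLinearMap.comp_apply, hDval, hjac]
      simp only [Sum.elim_inl, Pi.add_apply, mulVec_diagonal, dsSh]
      ring
  · -- inverter row `i`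
    refine (((hGk (Sum.inl (Sum.inr i))).const_mul (W.τ i)⁻¹).congr_of_eventuallyEq
      (Eventually.of_forall fun x' => ?_)).congr_fderiv ?_
    · simp only [dsDAEField, Sum.elim_inl, Sum.elim_inr]
    · ext h
      rw [hLapply, hrow, _root_.smul_apply, ContinuousLinearMap.comp_apply,
        ContinuousLinearMap.proj_apply, ContinuousLinearMap.comp_apply, hDval, hjac]
      simp only [Sum.elim_inl, Sum.elim_inr, Pi.add_apply, mulVec_diagonal, dsMass, smul_eq_mul,
        Pi.zero_apply, add_zero]
  · -- shunt row `l`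
    refine (((hGk (Sum.inr l)).const_mul (T l)⁻¹).congr_of_eventuallyEq
      (Eventually.of_forall fun x' => ?_)).congr_fderiv ?_
    · simp only [dsDAEField, Sum.elim_inr]
    · ext h
      rw [hLapply, hrow, _root_.smul_apply, ContinuousLinearMap.comp_apply,
        ContinuousLinearMap.proj_apply, ContinuousLinearMap.comp_apply, hDval]
      simp only [Sum.elim_inr, Pi.add_apply, mulVec_diagonal, dsMass, smul_eq_mul, zero_add,
        Matrix.neg_mulVec, Pi.neg_apply]
      simp only [dsSh]
      ring

/-- Continuity of a column-partitioned matrix field. [folklore] -/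
private theorem continuous_fromCols {X : Type*} [TopologicalSpace X] {r c₁ c₂ : Type*}
    {A : X → Matrix r c₁ ℝ} {B : X → Matrix r c₂ ℝ} (hA : Continuous A) (hB : Continuous B) :
    Continuous fun x => Matrix.fromCols (A x) (B x) := by
  refine continuous_pi fun i => continuous_pi fun j => ?_
  cases j with
  | inl j =>
    simp only [Matrix.fromCols_apply_inl]
    exact ((continuous_apply j).comp (continuous_apply i)).comp hA
  | inr j =>
    simp only [Matrix.fromCols_apply_inr]
    exact ((continuous_apply j).comp (continuous_apply i)).comp hB

/-- Continuity of a row-partitioned matrix field. [folklore] -/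
private theorem continuous_fromRows {X : Type*} [TopologicalSpace X] {r₁ r₂ c : Type*}
    {A : X → Matrix r₁ c ℝ} {B : X → Matrix r₂ c ℝ} (hA : Continuous A) (hB : Continuous B) :
    Continuous fun x => Matrix.fromRows (A x) (B x) := by
  refine continuous_pi fun i => continuous_pi fun j => ?_
  cases i with
  | inl i =>
    simp only [Matrix.fromRows_apply_inl]
    exact ((continuous_apply j).comp (continuous_apply i)).comp hA
  | inr i =>
    simp only [Matrix.fromRows_apply_inr]
    exact ((continuous_apply j).comp (continuous_apply i)).comp hB

/-- The Jacobian (3.11′) depends continuously on the flat state. [folklore] -/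
private theorem continuous_jac_flat :
    Continuous fun x : Fin n ⊕ (Fin m ⊕ Fin n) → ℝ => W.jac (dsDQx x) (dsVolt x) := by
  have hE : Continuous fun x : Fin n ⊕ (Fin m ⊕ Fin n) → ℝ => dsVolt (m := m) x :=
    continuous_pi fun k => continuous_apply _
  have hdiag : Continuous fun x : Fin n ⊕ (Fin m ⊕ Fin n) → ℝ => W.jacDiag (dsDQx x) (dsVolt x) := by
    refine continuous_pi fun k => ?_
    cases k with
    | inl l =>
      simp only [jacDiag, Sum.elim_inl, dsDQx, dsDQ, dsSh]
      exact ((continuous_const.mul (continuous_apply (Sum.inr (Sum.inr l)))).mul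
        (continuous_apply (Sum.inl l)))
    | inr i =>
      simp only [jacDiag, Sum.elim_inr, dsVolt, Sum.map_inr]
      exact ((continuous_const.mul ((continuous_apply (Sum.inr (Sum.inl i))).sub
        continuous_const)).add (continuous_const.mul (continuous_apply (Sum.inr (Sum.inl i)))))
  simp only [jac]
  exact ((hE.matrix_diagonal.matrix_mul continuous_const).add
    (continuous_const.matrix_mulVec hE).matrix_diagonal).add hdiag.matrix_diagonal

/-- **The Jacobian field of the DAE is continuous.** [cite: SimpsonporcoDorflerBullo2017, proof of Theorem 3.2 (smooth closed loop) with (3.16)] -/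
theorem continuous_dsDAEJac (T : Fin n → ℝ) : Continuous (W.dsDAEJac T) := by
  have hJ := continuous_jac_flat (W := W)
  have hb11 : Continuous fun M : Matrix (Fin n ⊕ Fin m) (Fin n ⊕ Fin m) ℝ => M.toBlocks₁₁ :=
    continuous_pi fun i => continuous_pi fun j =>
      (continuous_apply (Sum.inl j)).comp (continuous_apply (Sum.inl i))
  have hb12 : Continuous fun M : Matrix (Fin n ⊕ Fin m) (Fin n ⊕ Fin m) ℝ => M.toBlocks₁₂ :=
    continuous_pi fun i => continuous_pi fun j =>
      (continuous_apply (Sum.inr j)).comp (continuous_apply (Sum.inl i))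
  have hb21 : Continuous fun M : Matrix (Fin n ⊕ Fin m) (Fin n ⊕ Fin m) ℝ => M.toBlocks₂₁ :=
    continuous_pi fun i => continuous_pi fun j =>
      (continuous_apply (Sum.inl j)).comp (continuous_apply (Sum.inr i))
  have hb22 : Continuous fun M : Matrix (Fin n ⊕ Fin m) (Fin n ⊕ Fin m) ℝ => M.toBlocks₂₂ :=
    continuous_pi fun i => continuous_pi fun j =>
      (continuous_apply (Sum.inr j)).comp (continuous_apply (Sum.inr i))
  have hLL : Continuous fun x => W.jacLL (dsDQx x) (dsVolt x) := hb11.comp hJ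
  have hLI : Continuous fun x => W.jacLI (dsDQx x) (dsVolt x) := hb12.comp hJ
  have hIL : Continuous fun x => W.jacIL (dsDQx x) (dsVolt x) := hb21.comp hJ
  have hII : Continuous fun x => W.jacII (dsDQx x) (dsVolt x) := hb22.comp hJ
  have hsq : Continuous fun x : Fin n ⊕ (Fin m ⊕ Fin n) → ℝ =>
      diagonal fun l : Fin n => x (Sum.inl l) ^ 2 :=
    (continuous_pi fun l : Fin n => (continuous_apply (Sum.inl l)).pow 2).matrix_diagonal
  have hshE : Continuous fun x : Fin n ⊕ (Fin m ⊕ Fin n) → ℝ =>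
      diagonal fun l : Fin n => -(2 * x (Sum.inl l) * dsSh x l) := by
    refine (continuous_pi fun l : Fin n => ?_).matrix_diagonal
    simp only [dsSh]
    exact ((continuous_const.mul (continuous_apply (Sum.inl l))).mul
      (continuous_apply (Sum.inr (Sum.inr l)))).neg
  refine Continuous.matrix_fromBlocks hLL (continuous_fromCols hLI hsq)
    (continuous_const.matrix_mul (continuous_fromRows hIL hshE))
    (continuous_const.matrix_mul
      (Continuous.matrix_fromBlocks hII continuous_const continuous_const hsq.neg))

/-- At the state `(E_L, W₂(E_L, E_I*), b)` the Jacobian field has the companion's blocks: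
`[[𝒥_LL, 𝒥_Ld], [Λ_m𝒥_dL, Λ_m𝒥_dd]]`. [cite: SimpsonporcoDorflerBullo2017, Appendix A proof of Theorem 3.5 (p0019 L70–L71)] -/
theorem dsDAEJac_pack (T EL b : Fin n → ℝ) :
    W.dsDAEJac T (dsPack (W.liftState EL) b)
      = Matrix.fromBlocks (W.dsJLL EL b) (W.dsJLd EL b)
          (diagonal (W.dsMass T) * W.dsJdL EL b) (diagonal (W.dsMass T) * W.dsJdd EL b) := by
  have hV : dsVolt (m := m) (dsPack (W.liftState EL) b) = W.liftState EL := dsVolt_dsPack _ _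
  have hD : dsDQx (dsPack (W.liftState EL) b) = dsDQ EL b := rfl
  rw [dsDAEJac, hV, hD]
  rfl

/-- **The reduced Jacobian of the DAE field at `(E_L, W₂(E_L, E_I*), b)` is the companion's reduced
matrix `diag(τ, T)⁻¹(𝒥_dd − 𝒥_dL𝒥_LL⁻¹𝒥_Ld)`**, and its algebraic block is `𝒥_LL`.
[cite: SimpsonporcoDorflerBullo2017, proof of Theorem 3.2 («eliminating the algebraic equations from the system matrix») applied per Appendix A (p0019 L70–L71)] -/
theorem reducedJacobian_dsDAEJac (T EL b : Fin n → ℝ) :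
    reducedJacobian (W.dsDAEJac T (dsPack (W.liftState EL) b)) = W.dsRedStateMatrix EL b T ∧
      (W.dsDAEJac T (dsPack (W.liftState EL) b)).toBlocks₁₁ = W.dsJLL EL b := by
  rw [dsDAEJac_pack]
  refine ⟨?_, Matrix.toBlocks_fromBlocks₁₁ _ _ _ _⟩
  rw [reducedJacobian, Matrix.toBlocks_fromBlocks₁₁, Matrix.toBlocks_fromBlocks₁₂,
    Matrix.toBlocks_fromBlocks₂₁, Matrix.toBlocks_fromBlocks₂₂, dsRedStateMatrix, Matrix.mul_sub,
    Matrix.mul_assoc, Matrix.mul_assoc, Matrix.mul_assoc]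
  rfl

/-- Equilibria of (3.3), (3.16) are zeros of the DAE field. [cite: SimpsonporcoDorflerBullo2017, §3.3 Theorem 3.5 («equilibrium point … of the system (3.3), (3.16)»)] -/
theorem dsDAEField_eq_zero {Q : Fin n → ℝ} (T : Fin n → ℝ) {E : Fin n ⊕ Fin m → ℝ} {b : Fin n → ℝ}
    (hE : W.IsDSEquilibrium Q E b) : W.dsDAEField Q T (dsPack E b) = 0 := by
  have h0 : ∀ k, W.dsField Q E b k = 0 := fun k => congrFun hE k
  funext k
  rcases k with l | i | l
  · simp only [dsDAEField, dsVolt_dsPack, dsSh_dsPack, Sum.elim_inl, h0, Pi.zero_apply]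
  · simp only [dsDAEField, dsVolt_dsPack, dsSh_dsPack, Sum.elim_inl, Sum.elim_inr, h0, mul_zero,
      Pi.zero_apply]
  · simp only [dsDAEField, dsVolt_dsPack, dsSh_dsPack, Sum.elim_inr, h0, mul_zero, Pi.zero_apply]

/-! ## §2 Local exponential stability of the DAE at a certified equilibrium -/

/-- **The DAE lever applied to (3.3), (3.16)**: at a state `x* = (E_L, W₂(E_L, E_I*), b)` that is an
equilibrium of (3.3), (3.16), if the algebraic block `𝒥_LL` is invertible (index one) and the reduced
matrix `diag(τ, T)⁻¹(𝒥_dd − 𝒥_dL𝒥_LL⁻¹𝒥_Ld)` is Hurwitz, then there are `ρ, k, λ > 0` such that every C¹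
solution of the differential-algebraic system (3.3), (3.16) on `[0, T']` starting within `ρ` of `x*`
satisfies `‖x(t) − x*‖ ≤ k‖x(0) − x*‖e^{−λt}` on `[0, T']`.
[cite: SimpsonporcoDorflerBullo2017, Appendix A proof of Theorem 3.5 («applying the proof methodologies of Theorems 3.2 and 3.4 to the extended dynamics (3.3), (3.16) yields local exponential stability», p0019 L70–L71) with the proof of Theorem 3.2 ([RR:04]); Riaza2008, §3.1; Khalil2002, Theorem 4.7] -/
theorem dsEquilibrium_locallyExpStable {Q : Fin n → ℝ} {T EL b : Fin n → ℝ}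
    (heq : W.IsDSEquilibrium Q (W.liftState EL) b) (hU : IsUnit (W.dsJLL EL b).det)
    (hH : IsHurwitz (W.dsRedStateMatrix EL b T)) :
    ∃ ρ > 0, ∃ k > 0, ∃ lam > 0, ∀ (X : ℝ → Fin n ⊕ (Fin m ⊕ Fin n) → ℝ) (T' : ℝ),
      IsSemiExplicitDAESolutionOn (W.dsDAEField Q T) X T' →
        ‖X 0 - dsPack (W.liftState EL) b‖ < ρ →
          ∀ t ∈ Icc (0 : ℝ) T',
            ‖X t - dsPack (W.liftState EL) b‖ ≤ k * ‖X 0 - dsPack (W.liftState EL) b‖ * Real.exp (-lam * t) := by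
  obtain ⟨hred, h11⟩ := W.reducedJacobian_dsDAEJac T EL b
  refine exists_expStable_of_reducedJacobian_eig_re_neg (J := W.dsDAEJac T)
    (Eventually.of_forall fun x => W.hasFDerivAt_dsDAEField Q T x)
    (W.continuous_dsDAEJac T).continuousAt (W.dsDAEField_eq_zero T heq) ?_ ?_
  · rw [h11]; exact hU
  · rw [hred]; exact fun μ v hv h => hH μ v hv h

/-! ## §3 Theorem 3.5 as printed: the equilibrium is locally exponentially stable for the DAE -/

/-- **Theorem 3.5 (Stability with Dynamic Shunt Loads), differential-algebraic tier.**  Data as in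
Proposition 7.2 (`B` symmetric, off-diagonal `≥ 0`, zero row sums, `−(B + blkdiag(0, K_I)) ≻ 0`,
`K_i ≤ 0`, `E_i* > 0`), `τ_i > 0`, shunt time constants `T_l > 0`, and Theorem 3.3 (ii) at `I_shunt = 0`
(`B_redE_L* < 0`).  Then for ALL SUFFICIENTLY SMALL demands `Q_L`, WHENEVER they are inductive
(`Q_L < 0`): `x* = (E_L^{DS}, E_I^{DS}, b^{DS})` (positive voltages, `b^{DS} < 0`) is an equilibrium of
(3.3), (3.16) and is LOCALLY EXPONENTIALLY STABLE for the differential-algebraic system: there are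
`ρ, k, λ > 0` such that every C¹ solution of (3.3), (3.16) on `[0, T']` starting within `ρ` of `x*`
satisfies `‖x(t) − x*‖ ≤ k‖x(0) − x*‖e^{−λt}` on `[0, T']` (the formulas (3.17)–(3.18), the expansion and
local uniqueness are the companion's `theorem_3_5_equilibrium`).
[cite: SimpsonporcoDorflerBullo2017, §3.3 Theorem 3.5 («the corresponding equilibrium point `(E_L^{DS}, E_I^{DS}, b_dyn-shunt^{DS})` of the system (3.3), (3.16) is locally exponentially stable», p0012 L36–L38) and Appendix A (p0019 L68–L71); Riaza2008, §3.1; Khalil2002, Theorem 4.7] -/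
theorem theorem_3_5_locallyExpStable (hB : W.B.IsSymm) (hoff : ∀ k k', k ≠ k' → 0 ≤ W.B k k')
    (hrowB : ∀ k, ∑ k', W.B k k' = 0) (hM : (-(W.B + Matrix.fromBlocks 0 0 0 (diagonal W.K))).PosDef)
    (hK : ∀ i, W.K i ≤ 0) (hEs : ∀ i, 0 < W.Estar i) (hτ : ∀ i, 0 < W.τ i) {T : Fin n → ℝ}
    (hT : ∀ l, 0 < T l) (hI : ∀ l, W.redSource l < 0) :
    ∀ᶠ Q in 𝓝 (0 : Fin n → ℝ), (∀ l, Q l < 0) →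
      (∀ k, 0 < W.dsState Q k) ∧ (∀ l, W.dsShunt Q l < 0) ∧
      W.IsDSEquilibrium Q (W.dsState Q) (W.dsShunt Q) ∧
      ∃ ρ > 0, ∃ k > 0, ∃ lam > 0, ∀ (X : ℝ → Fin n ⊕ (Fin m ⊕ Fin n) → ℝ) (T' : ℝ),
        IsSemiExplicitDAESolutionOn (W.dsDAEField Q T) X T' →
          ‖X 0 - dsPack (W.dsState Q) (W.dsShunt Q)‖ < ρ →
            ∀ t ∈ Icc (0 : ℝ) T',
              ‖X t - dsPack (W.dsState Q) (W.dsShunt Q)‖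
                ≤ k * ‖X 0 - dsPack (W.dsState Q) (W.dsShunt Q)‖ * Real.exp (-lam * t) := by
  filter_upwards [theorem_3_5_redStateMatrix hB hoff hrowB hM hK hEs hτ hT hI] with Q hQ hneg
  obtain ⟨hpos, hb, heq, -, hH, hU⟩ := hQ hneg
  exact ⟨hpos, hb, heq, dsEquilibrium_locallyExpStable heq hU hH⟩

/-- **Theorem 3.5, differential-algebraic tier, from network data** (connected inductive network
`B = susceptanceMatrix w`, `w` symmetric `≥ 0`, `BranchConnected w`; `K_i < 0`, `E_i* > 0`, `τ_i > 0`,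
`T_l > 0`, at least one inverter; every load bus has a line to some inverter bus).
[cite: SimpsonporcoDorflerBullo2017, §3.3 Theorem 3.5 with §7 Lemma 7.1 and Proposition 7.2] -/
theorem theorem_3_5_locallyExpStable_of_network {w : Fin n ⊕ Fin m → Fin n ⊕ Fin m → ℝ}
    (hw : ∀ i j, w i j = w j i) (hw0 : ∀ i j, 0 ≤ w i j) (hconn : BranchConnected w)
    (hBw : W.B = susceptanceMatrix w) (hK : ∀ i, W.K i < 0) (hm : 0 < m) (hEs : ∀ i, 0 < W.Estar i)
    (hτ : ∀ i, 0 < W.τ i) {T : Fin n → ℝ} (hT : ∀ l, 0 < T l)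
    (hline : ∀ l : Fin n, ∃ i : Fin m, 0 < w (Sum.inl l) (Sum.inr i)) :
    ∀ᶠ Q in 𝓝 (0 : Fin n → ℝ), (∀ l, Q l < 0) →
      (∀ k, 0 < W.dsState Q k) ∧ (∀ l, W.dsShunt Q l < 0) ∧
      W.IsDSEquilibrium Q (W.dsState Q) (W.dsShunt Q) ∧
      ∃ ρ > 0, ∃ k > 0, ∃ lam > 0, ∀ (X : ℝ → Fin n ⊕ (Fin m ⊕ Fin n) → ℝ) (T' : ℝ),
        IsSemiExplicitDAESolutionOn (W.dsDAEField Q T) X T' →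
          ‖X 0 - dsPack (W.dsState Q) (W.dsShunt Q)‖ < ρ →
            ∀ t ∈ Icc (0 : ℝ) T',
              ‖X t - dsPack (W.dsState Q) (W.dsShunt Q)‖
                ≤ k * ‖X 0 - dsPack (W.dsState Q) (W.dsShunt Q)‖ * Real.exp (-lam * t) := by
  filter_upwards [theorem_3_5_redStateMatrix_of_network hw hw0 hconn hBw hK hm hEs hτ hT hline]
    with Q hQ hneg
  obtain ⟨hpos, hb, heq, -, hH, hU⟩ := hQ hneg
  exact ⟨hpos, hb, heq, dsEquilibrium_locallyExpStable heq hU hH⟩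

end QuadDroopNetwork

end Literature.MathematicalPhysics.PowerSystems
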